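import Literature.AnabelianGeometry.SemiGraphs.TemperedReconstructionCompat
import Literature.AnabelianGeometry.SemiGraphs.TemperedFunctorialityWith
import HarnessLib

/-!
# Corollary 3.9 "up to twist": the `∃ θ` reading of "`φ` is induced by `F`" (additive twin)

Mochizuki, *Semi-graphs of anabelioids*, Publ. RIMS **42** (2006), §3, Prop. 3.6 (iv) p. 39,
Rmk. 2.4.2 p. 21, Definition 3.8 and Corollary 3.9 pp. 42–43
[cite: MochizukiSemiAnbd2006, Cor 3.9 pp.42-43].

The tree's FROZEN `Hom.Induces F c𝒢 cℋ φ` (`TemperedReconstruction.lean` v2) reads "`B^temp(φ)` is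
isomorphic to the pull-back functor of `F` glued with the CHOSEN family of conjugating elements"
(`F.chartPullback = F.chartPullbackWith F.chosenConjugators`, definitional).  A morphism of semi-graphs
of anabelioids determines its pull-back functor on tempered coverings only up to the choice of that
family (the 2-cells of Rmk. 2.4.2; cell finding d4-F3, ruling ξ2 of abc-iut-L3-lead): two admissible
families give homomorphisms `φ`, `φ'` which are both compatible with `F` on the verticial and edge
subgroups but need not be globally conjugate.  The intended repair (ruling ξ2: `Induces := ∃ θ,
InducesWith θ`) was never filed; this module records it ADDITIVELY, without touching the frozen
statements: `Hom.InducesWith θ` ("`F^*_θ ≅ B^temp(φ)` through the charts"), `Hom.InducesUpToTwist`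
(`∃ θ`), and the twin `Cor39CompatUpToTwist` of `Cor39Compat` (`TemperedReconstructionCompat.lean`,
ruling χ2) with `Induces` replaced by `InducesUpToTwist` throughout and with (a) concluding
`IsCompatiblyQuasiGeometric` (so that (a) and (b) are the two directions of ONE correspondence).
Statements and one `Iff.rfl` only; the projections to the frozen readings and the discharge modulo
Thm. 3.7 (iii) are the proof file `TemperedReconstructionCor39UpToTwistProofs.lean` (the def-free form
of that discharge is `TemperedReconstructionCor39UpToTwistAssembly.lean`).  Nothing here takes a side on [IUTchIII]
Cor. 3.12, nor grades the reading; typed ≠ discharged.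
-/

open CategoryTheory

namespace Literature.AnabelianGeometry.SemiGraphs

namespace ProfiniteSemiGraph

universe u

variable {𝒢 ℋ : ProfiniteSemiGraph.{u}}

namespace Hom

/-- "`φ : π₁^temp(G) → π₁^temp(H)` is induced by `F : G → H` glued with the family `θ` of conjugating
elements" ([SemiAnbd] Prop. 3.6 (iv) p. 39 with the 2-cells of Rmk. 2.4.2 p. 21 made explicit):
`B^temp(φ)` is isomorphic to `c_H⁻¹ ⋙ F^*_θ ⋙ c_G`. [cite: MochizukiSemiAnbd2006, Prop 3.6(iv) p.39] -/
def InducesWith (F : Hom 𝒢 ℋ) (θ : F.ConjugatorFamily) (c𝒢 : TemperedPiChart 𝒢)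
    (cℋ : TemperedPiChart ℋ) (φ : c𝒢.G →ₜ* cℋ.G) : Prop :=
  Nonempty (F.chartPullbackWith θ c𝒢 cℋ ≅ BTemp.res φ)

/-- "`φ` is induced by `F`" UP TO TWIST: for SOME family `θ` of conjugating elements, `B^temp(φ)` is
isomorphic to `c_H⁻¹ ⋙ F^*_θ ⋙ c_G` — the reading of "arises from a morphism of semi-graphs of
anabelioids" ([SemiAnbd] p. 43 l. 13) invariant under the 2-cells of Rmk. 2.4.2 (ruling ξ2).
[cite: MochizukiSemiAnbd2006, Prop 3.6(iv) p.39] -/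
def InducesUpToTwist (F : Hom 𝒢 ℋ) (c𝒢 : TemperedPiChart 𝒢) (cℋ : TemperedPiChart ℋ)
    (φ : c𝒢.G →ₜ* cℋ.G) : Prop :=
  ∃ θ : F.ConjugatorFamily, F.InducesWith θ c𝒢 cℋ φ

/-- The frozen v2 `Hom.Induces` IS `InducesWith` for the chosen family (definitional).
[cite: MochizukiSemiAnbd2006, Prop 3.6(iv) p.39] -/
theorem induces_iff_inducesWith_chosen (F : Hom 𝒢 ℋ) (c𝒢 : TemperedPiChart 𝒢)
    (cℋ : TemperedPiChart ℋ) (φ : c𝒢.G →ₜ* cℋ.G) :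
    F.Induces c𝒢 cℋ φ ↔ F.InducesWith F.chosenConjugators c𝒢 cℋ φ :=
  Iff.rfl

end Hom

/-- **Corollary 3.9 over the compatible reading of Def. 3.8, "induced" read up to twist** ([SemiAnbd]
p. 42: "applying '`B^temp(−)`' determines a natural bijective correspondence between locally open
morphisms of semi-graphs of anabelioids `G → H` and quasi-geometric morphisms of temperoids
`B^temp(G) → B^temp(H)`"), named statement, TWIN of `Cor39Compat` (ruling χ2) with `Hom.Induces`
replaced by `Hom.InducesUpToTwist` (ruling ξ2) in (a), in (b)-existence and in (b)-uniqueness, and with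
(a) concluding COMPATIBLY quasi-geometric and (b)-uniqueness concluding equality of the underlying
morphisms of semi-graphs (vertex, edge AND branch maps; `Cor39Compat` records vertex and edge maps):
(a) a homomorphism induced up to twist by a locally open morphism is compatibly quasi-geometric; (b)
every compatibly quasi-geometric homomorphism is induced up to twist by a locally open morphism, whose
underlying morphism of semi-graphs is unique among all locally open morphisms inducing it up to twist.
OUR rendering of the correspondence (the two readings are recorded, not asserted equivalent to print).
[cite: MochizukiSemiAnbd2006, Cor 3.9 p.42] -/
def Cor39CompatUpToTwist : Prop :=
  ∀ (𝒢 ℋ : ProfiniteSemiGraph.{u}), Cor39Hypotheses 𝒢 → Cor39Hypotheses ℋ →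
    ∀ (c𝒢 : TemperedPiChart 𝒢) (cℋ : TemperedPiChart ℋ),
      (∀ (F : Hom 𝒢 ℋ), F.IsLocallyOpen → ∀ φ : c𝒢.G →ₜ* cℋ.G, F.InducesUpToTwist c𝒢 cℋ φ →
        IsCompatiblyQuasiGeometric φ) ∧
      ∀ φ : c𝒢.G →ₜ* cℋ.G, IsCompatiblyQuasiGeometric φ →
        ∃ F : Hom 𝒢 ℋ, F.IsLocallyOpen ∧ F.InducesUpToTwist c𝒢 cℋ φ ∧
          ∀ F' : Hom 𝒢 ℋ, F'.IsLocallyOpen → F'.InducesUpToTwist c𝒢 cℋ φ → F'.base = F.base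

end ProfiniteSemiGraph

end Literature.AnabelianGeometry.SemiGraphs
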